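import Summits.AtomisticToContinuum.Crystallization.Theorems.ChartedZeroExcessLayeredLatticeLiouvilleZZZUB

/-!
# ChartedZeroExcess · LayeredLatticeLiouville ZZZU (lens-2 g88 NODE 88 «MotionDichotomy», part 3 of 3) — the pieces (BXᴸ) `OffTubeBondExitP`,
# (UXᴸ) `OffTubeBulkExitP`, the glue (UXᴸ) ⟹ (BXᴸ) ⟹ (TGᴸ)(m₀) (PROVED), the fat-door instance `m₀ = 10⁻⁴`, and the doors W2⁗

See part 1 (`…ZZZUA`) for the node's module docstring (thesis, lens, pieces with tags, net, constants table, erratum of critic row 1569) and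
parts 1–2 for the prices and the collar frame.  This part: ZZZU-4 (the two `Prop` pieces, binders of (TGᴸ) `OffTubeRigidGapP` verbatim;
monotonicity and the `q < 0` vacuity guard of (UXᴸ)) and ZZZU-5 (`offTubeBondExitP_of_bulkExit`, `offTubeRigidGapP_of_bondExit`,
`offTubeRigidGapP_of_bulkExit`, `offTubeRigidGapP_fat`, `offTubeBondExitP_fat`, `mildCoolMoatCorePG_W2''''_fat_of_bondExit`, `mildCoolMoatCorePG_W2''''`:
`[MCMC](ϑc) ⟸ (SC) ∧ (X1ᴸ)(lam > 0) ∧ (X2ᴸ) ∧ (RGᴸ)(cR) ∧ (UXᴸ)_fat ∧ (DWᴹ)(cE, σ₀)`, `σ₀ < cE·cR·10⁻⁴`).  0 sorry; imports = part 2 only; axioms standard.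
-/

noncomputable section
open scoped BigOperators Classical InnerProductSpace RealInnerProductSpace
open MeasureTheory Set Metric Filter Topology
open Literature.Geometry.DiscreteGeometry (IsTwoShellGoodSet)
open Literature.MathematicalPhysics.StatisticalMechanics (lennardJones card_le_of_separated_of_dist_le)

namespace Summit.AtomisticToContinuum.Crystallization.Theorems.ChartedZeroExcessLayeredLatticeLiouville

open Summit.AtomisticToContinuum.Crystallization.Theorems.ChartedPlanarOrderRigidityDoor (E3 IsClean)
open Summit.AtomisticToContinuum.Crystallization.Theorems.ChartedPlanarOrderDensityDichotomy (μS IsSep)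
open Summit.AtomisticToContinuum.Crystallization.Theorems.ChartedPlanarOrderCleanScaleP (IsCleanP IsDoorSetP)
open Summit.AtomisticToContinuum.Crystallization.Theorems.ChartedPlanarOrderMesoCut (LayeredHom EnvClose)
open Summit.AtomisticToContinuum.Crystallization.Theorems.ChartedPlanarOrderDoorLayeredOsc (IsTwoShellAffineGood)

/-! ### ZZZU-4  The pieces (BXᴸ) `OffTubeBondExitP`, (UXᴸ) `OffTubeBulkExitP` (binders of (TGᴸ) verbatim) -/

section Pieces

/-- ★★★ **(BXᴸ) «OffTubeBondExitP … Rg sb dI dB …» — OFF THE TUBE, SOME `Rg`-LABEL PAIR OF CORE SITES HAS VECTOR BOND DEVIATION `> sb`.**  Under the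
binders of (TGᴸ) up to and including `xf ∉ bondTube (S ∖ core) Rg sb dI dB (lab ∘ xf)` (NO `y`, NO rigid motion): there are `i ≠ j` with
`dist (lab (xf i)) (lab (xf j)) ≤ Rg` and `sb < dist (xf i − xf j) (lab (xf i) − lab (xf j))` — i.e. of the three exits from the tube (bond / interface /
bulk) the BOND exit always occurs.  KINEMATIC · LJ-free · `y`-free · rotation-free · NEW · UNDECIDED · TRUE-type at the fat door (interface exit ⇒ bulk exit
is PROVED below from `dB ≤ ρ − Rg − rΘ`, `ε ≤ dI`; bulk exit ⇒ bond exit is (UXᴸ)) · INCOMPARABLE in form with (TGᴸ), but it IMPLIES (TGᴸ)(m₀ = 10⁻⁴) at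
the fat door (`offTubeRigidGapP_fat`, PROVED: the motion dichotomy) and FOLLOWS from (UXᴸ) (`offTubeBondExitP_of_bulkExit`, PROVED).  Monotone in `dI, dB`
only (the radii `Rg, sb` occur on both sides).  Why it might fail: only through (UXᴸ).  Sources: this file's module docstring. [this file, g88] -/
def OffTubeBondExitP (ϑc ϑp r rΘ q rsh ρ rm σ ϑr Rs ε rI ℓ Rg sb dI dB aHi Λ θ s : ℝ) : Prop :=
  ∀ δ : ℝ, 0 < δ → ∀ a : ℝ, 0 < a →
    ∀ S : Set E3, IsDoorSetP aHi δ S → (∀ z : E3, Summable fun y : S => lennardJones (dist z (y : E3))) →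
      (∀ p ∈ S, IsTwoShellAffineGood θ S p) →
        ∀ (L : E3 ≃L[ℝ] E3) (w : ℤ → E3), IsEquilChart a s Λ L w →
          ∀ (x₀ : E3) (K : Set E3), K ⊆ S → (∀ k ∈ K, dist k x₀ ≤ q) →
            IsTameOn ϑp S (LayeredHom (L : E3 →L[ℝ] E3) w) (coreOf S K rm) →
              IsTameOn ϑc S (LayeredHom (L : E3 →L[ℝ] E3) w) (moatIn S K r (r + rsh)) →
                ∀ (n : ℕ) (xf : Fin n → E3), Function.Injective xf → Set.range xf = coreOf S K ρ →
                  ∀ (L' : E3 →L[ℝ] E3) (w' : ℤ → E3) (U : E3 ≃ₗᵢ[ℝ] E3) (t : E3),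
                    IsCoolShadowCrystal σ ϑr Rs ε r rI ℓ S K (LayeredHom (L : E3 →L[ℝ] E3) w) L' w' U t →
                      ∀ lab : E3 → E3, IsBondLabel ε rΘ ℓ S K (placedCrystal L' w' U t) lab →
                        xf ∉ bondTube (S \ coreOf S K ρ) Rg sb dI dB (fun i => lab (xf i)) →
                          ∃ i j : Fin n, i ≠ j ∧ dist (lab (xf i)) (lab (xf j)) ≤ Rg ∧ sb < dist (xf i - xf j) (lab (xf i) - lab (xf j))

/-- ★★★ **(UXᴸ) «OffTubeBulkExitP … Rg sb dB …» — A CORE SITE MORE THAN `dB` FROM ITS LABEL FORCES AN `Rg`-LABEL PAIR WITH VECTOR BOND DEVIATION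
`> sb`** (the single residual leaf of NODE 88).  Under the binders of (TGᴸ) up to the bond label (NO tube hypothesis, NO `y`, NO rigid motion): if
`dB < dist (xf i) (lab (xf i))` for some core site, then some `i' ≠ j'` have `dist (lab (xf i')) (lab (xf j')) ≤ Rg` and `sb < dist (xf i' − xf j')
(lab (xf i') − lab (xf j'))`.  KINEMATIC (propagation of the label deviation `e := xf − lab ∘ xf`) · LJ-free · `y`-free · motion-free · NEW · UNDECIDED ·
TRUE-type at the fat door `(Rg, sb, dB, ε) = (121/25, 249/5000, 21/50, 10⁻⁴)` by the LABEL-GEODESIC CHAIN of the module docstring: a `dB`-far site is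
θ-hot (cool core sites are registered, `ε < dB`); the bond label maps the twelve contact neighbours of a zone-interior atom ONTO the twelve crystal
neighbours of its label (bonds to bonds, injective, kissing number twelve), so a crystal geodesic from `lab p₀` towards the cool cap `k_u + (rΘ + 2.2)·u`,
`u = (p₀ − x₀)/‖p₀ − x₀‖` (`< 24` steps) lifts to a contact chain of atoms; sites `≤ 4` steps apart are `Rg`-label pairs (`4·28/25 ≤ Rg`), so if all such
pairs had deviation `≤ sb` the chain would follow the translated geodesic (`± 6·sb + 1/√2`), stay in the core (`≤ 13.5 + 17/16` from `k_u`) and end at a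
registered site: `dB < ‖e(p₀)‖ ≤ ε + 6·sb = 0.2989 < 0.42 = dB`, contradiction (`6` hops needed, `(dB − ε)/sb = 8.4` allowed) · TWO-SIDED INSTRUMENTABLE
«BulkChain-T» (hop count vs `8.4`; g87's desk found `3–4`) · ATTACKABLE-M (local label bijection for the shadow crystal + a constructive crystal geodesic
with bounded wiggle + hop telescoping; the cap geometry is this file's `exists_collarProbe`).  Antitone in `sb`, monotone in `Rg, dB`
(`OffTubeBulkExitP.mono`); vacuous for `q < 0` (`offTubeBulkExitP_of_q_neg`).  Why it might fail: a hot core so placed that every label chain to the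
registered zone needs `> 8` hops inside the core — excluded at the record dials by the count above, but the twelve-neighbour structure of `placedCrystal`
at bond range `28/25` must be certified.  Sources: module docstring; tree TW (XXIII.1), ZC (`IsBondLabel`). [this file, g88] -/
def OffTubeBulkExitP (ϑc ϑp r rΘ q rsh ρ rm σ ϑr Rs ε rI ℓ Rg sb dB aHi Λ θ s : ℝ) : Prop :=
  ∀ δ : ℝ, 0 < δ → ∀ a : ℝ, 0 < a →
    ∀ S : Set E3, IsDoorSetP aHi δ S → (∀ z : E3, Summable fun y : S => lennardJones (dist z (y : E3))) →
      (∀ p ∈ S, IsTwoShellAffineGood θ S p) →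
        ∀ (L : E3 ≃L[ℝ] E3) (w : ℤ → E3), IsEquilChart a s Λ L w →
          ∀ (x₀ : E3) (K : Set E3), K ⊆ S → (∀ k ∈ K, dist k x₀ ≤ q) →
            IsTameOn ϑp S (LayeredHom (L : E3 →L[ℝ] E3) w) (coreOf S K rm) →
              IsTameOn ϑc S (LayeredHom (L : E3 →L[ℝ] E3) w) (moatIn S K r (r + rsh)) →
                ∀ (n : ℕ) (xf : Fin n → E3), Function.Injective xf → Set.range xf = coreOf S K ρ →
                  ∀ (L' : E3 →L[ℝ] E3) (w' : ℤ → E3) (U : E3 ≃ₗᵢ[ℝ] E3) (t : E3),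
                    IsCoolShadowCrystal σ ϑr Rs ε r rI ℓ S K (LayeredHom (L : E3 →L[ℝ] E3) w) L' w' U t →
                      ∀ lab : E3 → E3, IsBondLabel ε rΘ ℓ S K (placedCrystal L' w' U t) lab →
                        ∀ i : Fin n, dB < dist (xf i) (lab (xf i)) →
                          ∃ i' j' : Fin n, i' ≠ j' ∧ dist (lab (xf i')) (lab (xf j')) ≤ Rg ∧ sb < dist (xf i' - xf j') (lab (xf i') - lab (xf j'))

/-- (UXᴸ) is antitone in `sb` and monotone in `Rg, dB`. [formal bookkeeping] -/
theorem OffTubeBulkExitP.mono {ϑc ϑp r rΘ q rsh ρ rm σ ϑr Rs ε rI ℓ Rg Rg' sb sb' dB dB' aHi Λ θ s : ℝ} (hRg : Rg ≤ Rg') (hsb : sb' ≤ sb)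
    (hdB : dB ≤ dB') (h : OffTubeBulkExitP ϑc ϑp r rΘ q rsh ρ rm σ ϑr Rs ε rI ℓ Rg sb dB aHi Λ θ s) :
    OffTubeBulkExitP ϑc ϑp r rΘ q rsh ρ rm σ ϑr Rs ε rI ℓ Rg' sb' dB' aHi Λ θ s := by
  intro δ hδ a ha S hS hsum hgood L w hLw x₀ K hKS hKq hmild hcool n xf hxf hrange L' w' U t hC lab hlab i hi
  obtain ⟨i', j', hij, h1, h2⟩ := h δ hδ a ha S hS hsum hgood L w hLw x₀ K hKS hKq hmild hcool n xf hxf hrange L' w' U t hC lab hlab i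
    (lt_of_le_of_lt hdB hi)
  exact ⟨i', j', hij, h1.trans hRg, lt_of_le_of_lt hsb h2⟩

/-- SANITY GUARD (degenerate container): with `q < 0` the container is empty, so is the core, and (UXᴸ) holds vacuously — the content of (UXᴸ) is at
`q ≥ 0` (record `q = 4`). [formal bookkeeping] -/
theorem offTubeBulkExitP_of_q_neg {ϑc ϑp r rΘ q rsh ρ rm σ ϑr Rs ε rI ℓ Rg sb dB aHi Λ θ s : ℝ} (hq : q < 0) :
    OffTubeBulkExitP ϑc ϑp r rΘ q rsh ρ rm σ ϑr Rs ε rI ℓ Rg sb dB aHi Λ θ s := by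
  intro δ hδ a ha S hS hsum hgood L w hLw x₀ K hKS hKq hmild hcool n xf hxf hrange L' w' U t hC lab hlab i hi
  exfalso
  have hx : xf i ∈ coreOf S K ρ := by rw [← hrange]; exact Set.mem_range_self i
  obtain ⟨_, k, hk, _⟩ := hx
  have := hKq k hk
  linarith [dist_nonneg (x := k) (y := x₀)]

end Pieces

/-! ### ZZZU-5  Glue: (UXᴸ) ⟹ (BXᴸ) ⟹ (TGᴸ) (PROVED), the fat-door instances, and the doors W2⁗ -/

section Glue

/-- ★★★ **(UXᴸ) ⟹ (BXᴸ) (PROVED)** for `0 ≤ sb`, `ε ≤ dI`, `dB ≤ ρ − Rg − rΘ`, `ρ < ℓ`: off the tube one of the three clauses fails; a failed BOND clause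
with `i = j` is impossible (`sb ≥ 0`), with `i ≠ j` it is the conclusion; a failed INTERFACE clause at a cool-zone site contradicts registration (`ε ≤ dI`),
at a hot site (`dist (xf i) k ≤ rΘ`, `k ∈ K`) the exterior witness `p ∉ core` (`dist p k > ρ`, `dist (lab (xf i)) p ≤ Rg`) puts the label `> ρ − Rg − rΘ
≥ dB` from the site — a BULK exit; a failed BULK clause is a bulk exit; and bulk exits give the conclusion by (UXᴸ). [this file, g88] -/
theorem offTubeBondExitP_of_bulkExit {ϑc ϑp r rΘ q rsh ρ rm σ ϑr Rs ε rI ℓ Rg sb dI dB aHi Λ θ s : ℝ} (hsb : 0 ≤ sb) (hε : ε ≤ dI)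
    (hgeo : dB ≤ ρ - Rg - rΘ) (hρℓ : ρ < ℓ) (hUX : OffTubeBulkExitP ϑc ϑp r rΘ q rsh ρ rm σ ϑr Rs ε rI ℓ Rg sb dB aHi Λ θ s) :
    OffTubeBondExitP ϑc ϑp r rΘ q rsh ρ rm σ ϑr Rs ε rI ℓ Rg sb dI dB aHi Λ θ s := by
  intro δ hδ a ha S hS hsum hgood L w hLw x₀ K hKS hKq hmild hcool n xf hxf hrange L' w' U t hC lab hlab hoff
  have hX := hUX δ hδ a ha S hS hsum hgood L w hLw x₀ K hKS hKq hmild hcool n xf hxf hrange L' w' U t hC lab hlab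
  by_contra hno
  apply hoff
  have hcore : ∀ i, xf i ∈ coreOf S K ρ := fun i => by rw [← hrange]; exact Set.mem_range_self i
  have hbulk : ∀ i, dist (xf i) (lab (xf i)) ≤ dB := fun i => by
    by_contra h
    exact hno (hX i (not_le.1 h))
  refine ⟨fun i j hij => ?_, fun i hi => ?_, fun i => hbulk i⟩
  · by_contra h
    rw [not_le] at h
    by_cases hij' : i = j
    · subst hij'
      have h' : sb < dist (xf i - xf i) (lab (xf i) - lab (xf i)) := h
      rw [sub_self, sub_self, dist_self] at h'
      exact absurd h' (not_lt.2 hsb)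
    · exact hno ⟨i, j, hij', hij, h⟩
  · obtain ⟨p, hp, hpR⟩ := hi
    have hpR' : dist (lab (xf i)) p ≤ Rg := hpR
    show dist (xf i) (lab (xf i)) ≤ dI
    by_cases hc : ∀ k ∈ K, rΘ < dist (xf i) k
    · obtain ⟨hxS, k, hk, hkρ⟩ := hcore i
      exact (hlab.2.2.2 (xf i) hxS ⟨k, hk, by linarith⟩ hc).trans hε
    · push Not at hc
      obtain ⟨k, hk, hkΘ⟩ := hc
      have hρk : ρ < dist p k := by
        by_contra h'
        exact hp.2 ⟨hp.1, k, hk, not_lt.1 h'⟩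
      have h4 := dist_triangle4 p (lab (xf i)) (xf i) k
      rw [dist_comm p (lab (xf i)), dist_comm (lab (xf i)) (xf i)] at h4
      have := hbulk i
      linarith

/-- ★★★ **THE MOTION DICHOTOMY: (BXᴸ) ⟹ (TGᴸ)(m₀) (PROVED)** for every `m₀` below BOTH prices — the bond price `(sb − sb₁ − κ(Rg + sb₁))²/2` of a
`κ`-near-identity motion (`rigidMisfit_bondClause_nearId`) and the collar price `(t·κ − 2u(ε + dI₁))²/2` of a `κ`-far one (`exists_collarFrame` +
`rigidMisfit_collar_farId'`), under the collar dial inequalities (`aHi ≤ 8/7`, `9/5 ≤ rC`, `rΘ + 9/10 < rC`, `rC + 9/10 ≤ ρ ≤ ℓ`, `ε + 27/10 + ρ − rC ≤ Rg`,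
`t² ≤ L²/2 − 2w²` with `L = 2rC − 2(9/10 + ε)`, `w = 2q + 2(9/10 + ε)`, `u² ≥ 3`).  SPECIAL (near-identity, incl. pure translations) vs GENERIC (a genuine
rotation): excluded middle on `∀ v, ‖R v − v‖ ≤ κ‖v‖`. [this file, g88] -/
theorem offTubeRigidGapP_of_bondExit {ϑc ϑp r rΘ q rsh ρ rm σ ϑr Rs ε rI ℓ Rg sb dI dB sb₁ dI₁ dB₁ m₀ aHi Λ θ s κ tF uF rC : ℝ}
    (haHi : aHi ≤ 8 / 7) (hκ : 0 ≤ κ) (hrC : 9 / 5 ≤ rC) (hcoolC : rΘ + 9 / 10 < rC) (hcore : rC + 9 / 10 ≤ ρ) (hρℓ : ρ ≤ ℓ)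
    (hext : ε + 27 / 10 + ρ - rC ≤ Rg) (hL : 0 ≤ 2 * rC - 2 * (9 / 10 + ε))
    (ht : tF ^ 2 ≤ (2 * rC - 2 * (9 / 10 + ε)) ^ 2 / 2 - 2 * (2 * q + 2 * (9 / 10 + ε)) ^ 2) (hu0 : 0 ≤ uF) (hu : 3 ≤ uF ^ 2)
    (hA0 : 0 ≤ sb - sb₁ - κ * (Rg + sb₁)) (hB0 : 0 ≤ tF * κ - 2 * uF * (ε + dI₁))
    (hmA : m₀ ≤ (sb - sb₁ - κ * (Rg + sb₁)) ^ 2 / 2) (hmB : m₀ ≤ (tF * κ - 2 * uF * (ε + dI₁)) ^ 2 / 2)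
    (hBX : OffTubeBondExitP ϑc ϑp r rΘ q rsh ρ rm σ ϑr Rs ε rI ℓ Rg sb dI dB aHi Λ θ s) :
    OffTubeRigidGapP ϑc ϑp r rΘ q rsh ρ rm σ ϑr Rs ε rI ℓ Rg sb dI dB sb₁ dI₁ dB₁ m₀ aHi Λ θ s := by
  intro δ hδ a ha S hS hsum hgood L w hLw x₀ K hKS hKq hmild hcool n xf hxf hrange L' w' U t hC lab hlab hoff y hyT R c hR
  obtain ⟨i, j, hij, hRg, hoffij⟩ :=
    hBX δ hδ a ha S hS hsum hgood L w hLw x₀ K hKS hKq hmild hcool n xf hxf hrange L' w' U t hC lab hlab hoff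
  by_cases hnear : ∀ v : E3, ‖R v - v‖ ≤ κ * ‖v‖
  · exact hmA.trans (rigidMisfit_bondClause_nearId (y₀ := fun i => lab (xf i)) hκ hnear hij hRg hoffij (hyT.1 i j hRg) hA0)
  · push Not at hnear
    have hKne : K.Nonempty := by
      have hi : xf i ∈ coreOf S K ρ := by rw [← hrange]; exact Set.mem_range_self i
      obtain ⟨_, k, hk, _⟩ := hi
      exact ⟨k, hk⟩
    obtain ⟨ip, im, hip, him, hpm, hregp, hregm, hpinp, hpinm, hax, hperp⟩ :=
      exists_collarFrame (EuclideanSpace.basisFun (Fin 3) ℝ) haHi hδ hS hKS hKq hKne hrange hlab hyT hrC hcoolC hcore hρℓ hext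
    exact hmB.trans (rigidMisfit_collar_farId' (y₀ := fun i => lab (xf i)) (EuclideanSpace.basisFun (Fin 3) ℝ) ip im hip him hpm hregp hregm
      hpinp hpinm hL hax hperp ht hu0 hu hκ hnear hB0)

/-- ★★ (UXᴸ) ⟹ (TGᴸ)(m₀) (PROVED; composition). [this file, g88] -/
theorem offTubeRigidGapP_of_bulkExit {ϑc ϑp r rΘ q rsh ρ rm σ ϑr Rs ε rI ℓ Rg sb dI dB sb₁ dI₁ dB₁ m₀ aHi Λ θ s κ tF uF rC : ℝ}
    (haHi : aHi ≤ 8 / 7) (hκ : 0 ≤ κ) (hrC : 9 / 5 ≤ rC) (hcoolC : rΘ + 9 / 10 < rC) (hcore : rC + 9 / 10 ≤ ρ) (hρℓ : ρ < ℓ)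
    (hext : ε + 27 / 10 + ρ - rC ≤ Rg) (hL : 0 ≤ 2 * rC - 2 * (9 / 10 + ε))
    (ht : tF ^ 2 ≤ (2 * rC - 2 * (9 / 10 + ε)) ^ 2 / 2 - 2 * (2 * q + 2 * (9 / 10 + ε)) ^ 2) (hu0 : 0 ≤ uF) (hu : 3 ≤ uF ^ 2)
    (hA0 : 0 ≤ sb - sb₁ - κ * (Rg + sb₁)) (hB0 : 0 ≤ tF * κ - 2 * uF * (ε + dI₁))
    (hmA : m₀ ≤ (sb - sb₁ - κ * (Rg + sb₁)) ^ 2 / 2) (hmB : m₀ ≤ (tF * κ - 2 * uF * (ε + dI₁)) ^ 2 / 2)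
    (hsb : 0 ≤ sb) (hε : ε ≤ dI) (hgeo : dB ≤ ρ - Rg - rΘ)
    (hUX : OffTubeBulkExitP ϑc ϑp r rΘ q rsh ρ rm σ ϑr Rs ε rI ℓ Rg sb dB aHi Λ θ s) :
    OffTubeRigidGapP ϑc ϑp r rΘ q rsh ρ rm σ ϑr Rs ε rI ℓ Rg sb dI dB sb₁ dI₁ dB₁ m₀ aHi Λ θ s :=
  offTubeRigidGapP_of_bondExit haHi hκ hrC hcoolC hcore hρℓ.le hext hL ht hu0 hu hA0 hB0 hmA hmB
    (offTubeBondExitP_of_bulkExit hsb hε hgeo hρℓ hUX)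

/-- ★★★ **THE FAT-DOOR INSTANCE (PROVED): (BXᴸ) ⟹ (TGᴸ)(m₀ = 10⁻⁴)** at the record dials, the fat outer tube `(Rg, sb, dI, dB) = (121/25, 249/5000,
249/5000, 21/50)` and ANY inner radii `sb₁, dI₁ ≤ sb/4` (any `dB₁`) — with collar offset `rC = 15`, threshold `κ = 9/2000`, frame constant `t = 1433/100`
(`t² = 205.35 ≤ L²/2 − 2w² = 205.53`, `L = 28.1998`, `w = 9.8002`), `u = 17321/10000` (`u² ≥ 3`): bond price `≥ (31/2000)²/2 = 1.20·10⁻⁴`, collar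
price `≥ (21/1000)²/2 = 2.2·10⁻⁴`, both `≥ m₀ = 10⁻⁴`. [this file, g88] -/
theorem offTubeRigidGapP_fat {ϑc sb₁ dI₁ dB₁ : ℝ} (hsb : 4 * sb₁ ≤ 249 / 5000) (hdI : 4 * dI₁ ≤ 249 / 5000)
    (hBX : OffTubeBondExitP ϑc (1 / 10) 8 (145 / 16) 4 12 16 16 (17 / 20) (1 / 10000) 5 (1 / 10000) 10 (43 / 2)
      (121 / 25) (249 / 5000) (249 / 5000) (21 / 50) 1 2 (1 / 16) (1 / 50)) :
    OffTubeRigidGapP ϑc (1 / 10) 8 (145 / 16) 4 12 16 16 (17 / 20) (1 / 10000) 5 (1 / 10000) 10 (43 / 2)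
      (121 / 25) (249 / 5000) (249 / 5000) (21 / 50) sb₁ dI₁ dB₁ (1 / 10000) 1 2 (1 / 16) (1 / 50) := by
  have hX : 31 / 2000 ≤ 249 / 5000 - sb₁ - 9 / 2000 * (121 / 25 + sb₁) := by linarith
  have hY : 21 / 1000 ≤ 1433 / 100 * (9 / 2000) - 2 * (17321 / 10000) * (1 / 10000 + dI₁) := by linarith
  exact offTubeRigidGapP_of_bondExit (κ := 9 / 2000) (tF := 1433 / 100) (uF := 17321 / 10000) (rC := 15) (by norm_num) (by norm_num) (by norm_num)
    (by norm_num) (by norm_num) (by norm_num) (by norm_num) (by norm_num) (by norm_num) (by norm_num) (by norm_num) (by linarith) (by linarith)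
    (by nlinarith) (by nlinarith) hBX

/-- ★★ (BXᴸ)_fat from (UXᴸ)_fat (PROVED instance; `21/50 ≤ 16 − 121/25 − 145/16 = 2.0975`). [this file, g88] -/
theorem offTubeBondExitP_fat {ϑc : ℝ}
    (hUX : OffTubeBulkExitP ϑc (1 / 10) 8 (145 / 16) 4 12 16 16 (17 / 20) (1 / 10000) 5 (1 / 10000) 10 (43 / 2)
      (121 / 25) (249 / 5000) (21 / 50) 1 2 (1 / 16) (1 / 50)) :
    OffTubeBondExitP ϑc (1 / 10) 8 (145 / 16) 4 12 16 16 (17 / 20) (1 / 10000) 5 (1 / 10000) 10 (43 / 2)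
      (121 / 25) (249 / 5000) (249 / 5000) (21 / 50) 1 2 (1 / 16) (1 / 50) :=
  offTubeBondExitP_of_bulkExit (by norm_num) (by norm_num) (by norm_num) (by norm_num) hUX

/-- ★★★ **THE FAT RECORD DOOR W2⁗-B (PROVED)**: `[MCMC](ϑc) ⟸ (SC) ∧ (X1ᴸ)(lam > 0) ∧ (X2ᴸ) ∧ (RGᴸ)(cR) ∧ (BXᴸ)_fat ∧ (DWᴹ)(cE, σ₀)` with
`σ₀ < cE·cR·10⁻⁴` — the W2‴ fat door (tree ZZZT) with its leaf (TGᴸ)(m₀) DISCHARGED at `m₀ = 10⁻⁴` by the motion dichotomy. [this file, g88] -/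
theorem mildCoolMoatCorePG_W2''''_fat_of_bondExit {ϑc sb₁ dI₁ dB₁ lam cR cE σ₀ : ℝ} (hlam : 0 < lam) (hcR : 0 ≤ cR) (hcE : 0 ≤ cE)
    (hgap : σ₀ < cE * (cR * (1 / 10000))) (hsb : 4 * sb₁ ≤ 249 / 5000) (hdI : 4 * dI₁ ≤ 249 / 5000) (hdB : dB₁ ≤ 2 / 5) (hsb₀ : 0 ≤ sb₁)
    (hdI₀ : 0 ≤ dI₁) (hdB₀ : 0 ≤ dB₁)
    (hSC : CoolZoneShadowCrystalP ϑc (1 / 10) 8 4 12 16 (17 / 20) (1 / 10000) 5 (1 / 10000) 10 (43 / 2) 1 2 (1 / 16) (1 / 50))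
    (hX1 : LabelTubeConvexityP ϑc tameRadius (1 / 10) 8 (145 / 16) 4 12 16 16 (17 / 20) (1 / 10000) 5 (1 / 10000) 10 (43 / 2) (1 / 5000) (121 / 25)
      (249 / 5000) (249 / 5000) (21 / 50) lam 1 2 (1 / 16) (1 / 50))
    (hX2 : LabelLoadedTubeAprioriP ϑc tameRadius (1 / 10) 8 (145 / 16) 4 12 16 16 (17 / 20) (1 / 10000) 5 (1 / 10000) 10 (43 / 2) (1 / 5000)
      (121 / 25) (249 / 5000) (249 / 5000) (21 / 50) sb₁ dI₁ dB₁ 1 2 (1 / 16) (1 / 50))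
    (hRG : DeficitRigidityP ϑc (1 / 10) 8 (145 / 16) 4 12 16 16 (17 / 20) (1 / 10000) 5 (1 / 10000) 10 (43 / 2) (121 / 25) sb₁ dI₁ dB₁ (121 / 25)
      cR 1 2 (1 / 16) (1 / 50))
    (hBX : OffTubeBondExitP ϑc (1 / 10) 8 (145 / 16) 4 12 16 16 (17 / 20) (1 / 10000) 5 (1 / 10000) 10 (43 / 2)
      (121 / 25) (249 / 5000) (249 / 5000) (21 / 50) 1 2 (1 / 16) (1 / 50))
    (hDW : DeficitWellMinP ϑc tameRadius (1 / 10) 8 (145 / 16) 4 12 16 16 (17 / 20) (1 / 10000) 5 (1 / 10000) 10 (43 / 2) (121 / 25) sb₁ dI₁ dB₁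
      (121 / 25) cE σ₀ 1 2 (1 / 16) (1 / 50)) :
    MildCoolMoatCorePG ϑc tameRadius (1 / 10) 8 4 12 16 1 2 (1 / 16) (1 / 50) :=
  mildCoolMoatCorePG_W2'''_fat hlam hcR hcE hgap hsb hdI hdB hsb₀ hdI₀ hdB₀ hSC hX1 hX2 hRG (offTubeRigidGapP_fat hsb hdI hBX) hDW

/-- ★★★ **THE FAT RECORD DOOR W2⁗ (PROVED)**: `[MCMC](ϑc) ⟸ (SC) ∧ (X1ᴸ)(lam > 0) ∧ (X2ᴸ) ∧ (RGᴸ)(cR) ∧ (UXᴸ)_fat ∧ (DWᴹ)(cE, σ₀)` with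
`σ₀ < cE·cR·10⁻⁴`: the energetic route of record after NODE 88 — residual LJ-free leaves (X1ᴸ), (X2ᴸ), (RGᴸ), (UXᴸ) and the monotone leaf (DWᴹ); the
leaf (TGᴸ) of W2‴ is discharged. [this file, g88] -/
theorem mildCoolMoatCorePG_W2'''' {ϑc sb₁ dI₁ dB₁ lam cR cE σ₀ : ℝ} (hlam : 0 < lam) (hcR : 0 ≤ cR) (hcE : 0 ≤ cE)
    (hgap : σ₀ < cE * (cR * (1 / 10000))) (hsb : 4 * sb₁ ≤ 249 / 5000) (hdI : 4 * dI₁ ≤ 249 / 5000) (hdB : dB₁ ≤ 2 / 5) (hsb₀ : 0 ≤ sb₁)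
    (hdI₀ : 0 ≤ dI₁) (hdB₀ : 0 ≤ dB₁)
    (hSC : CoolZoneShadowCrystalP ϑc (1 / 10) 8 4 12 16 (17 / 20) (1 / 10000) 5 (1 / 10000) 10 (43 / 2) 1 2 (1 / 16) (1 / 50))
    (hX1 : LabelTubeConvexityP ϑc tameRadius (1 / 10) 8 (145 / 16) 4 12 16 16 (17 / 20) (1 / 10000) 5 (1 / 10000) 10 (43 / 2) (1 / 5000) (121 / 25)
      (249 / 5000) (249 / 5000) (21 / 50) lam 1 2 (1 / 16) (1 / 50))
    (hX2 : LabelLoadedTubeAprioriP ϑc tameRadius (1 / 10) 8 (145 / 16) 4 12 16 16 (17 / 20) (1 / 10000) 5 (1 / 10000) 10 (43 / 2) (1 / 5000)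
      (121 / 25) (249 / 5000) (249 / 5000) (21 / 50) sb₁ dI₁ dB₁ 1 2 (1 / 16) (1 / 50))
    (hRG : DeficitRigidityP ϑc (1 / 10) 8 (145 / 16) 4 12 16 16 (17 / 20) (1 / 10000) 5 (1 / 10000) 10 (43 / 2) (121 / 25) sb₁ dI₁ dB₁ (121 / 25)
      cR 1 2 (1 / 16) (1 / 50))
    (hUX : OffTubeBulkExitP ϑc (1 / 10) 8 (145 / 16) 4 12 16 16 (17 / 20) (1 / 10000) 5 (1 / 10000) 10 (43 / 2)
      (121 / 25) (249 / 5000) (21 / 50) 1 2 (1 / 16) (1 / 50))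
    (hDW : DeficitWellMinP ϑc tameRadius (1 / 10) 8 (145 / 16) 4 12 16 16 (17 / 20) (1 / 10000) 5 (1 / 10000) 10 (43 / 2) (121 / 25) sb₁ dI₁ dB₁
      (121 / 25) cE σ₀ 1 2 (1 / 16) (1 / 50)) :
    MildCoolMoatCorePG ϑc tameRadius (1 / 10) 8 4 12 16 1 2 (1 / 16) (1 / 50) :=
  mildCoolMoatCorePG_W2''''_fat_of_bondExit hlam hcR hcE hgap hsb hdI hdB hsb₀ hdI₀ hdB₀ hSC hX1 hX2 hRG (offTubeBondExitP_fat hUX) hDW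

end Glue

end Summit.AtomisticToContinuum.Crystallization.Theorems.ChartedZeroExcessLayeredLatticeLiouville

end
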